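import Mathlib.MeasureTheory.Group.FundamentalDomain
import Mathlib.MeasureTheory.Measure.Haar.Basic
import Mathlib.MeasureTheory.Function.LpSpace.Basic
import Mathlib.MeasureTheory.Integral.Bochner.Basic
import Mathlib.RepresentationTheory.Intertwining
import Mathlib.RepresentationTheory.Irreducible
import Literature.NumberTheory.Automorphic.AdelicGroupData
import Literature.NumberTheory.Automorphic.HilbertRepSpectrum
import Literature.NumberTheory.Automorphic.AutomorphicSpectrum
import Literature.NumberTheory.Automorphic.GLnAdelicStructure
import HarnessLib

-- provenance: harness21/H21/H21/Prelude/AutomorphicAxiomatic/GLnCuspidalSpectrum.lean @ 3832856 (interim HEAD d8f2665); M5 mechanical rewrite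
/-!
# The cuspidal spectrum of `GL_n` over a number field (trunk G19 AutomorphicAxiomatic, item C13;
notions `L2_discrete_spectrum`, `automorphic_representation`)

The honest cuspidal spectrum `L²_cusp(GL_n(𝔸_K) ⧸ A_G GL_n(K)) ≤ L²` for the datum
`AdelicGroupData.gl n K` (`Adelic = GL_n(𝔸_K)`, automorphic quotient by `A_G · GL_n(K)` with
`A_G = ℝ_{>0}`, left cosets; outline D10), cuspidal automorphic representations of `GL_n(𝔸_K)`,
and the classical structural theorems about them.

## Contents

* Unipotent radicals of the standard maximal parabolics over any commutative ring `R` (moved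
  here from `GLnAdelicStructure`, review F10): `blockNilpotent n k R = 𝔫_k` (matrices supported
  in the block `i < k ≤ j`), `blockNilpotent_mul_self` (`𝔫_k² = 0`, proved),
  `unipotentOfBlock n k R : Multiplicative 𝔫_k →* GL_n(R)`, `X ↦ 1 + X` (honest homomorphism),
  `standardUnipotentRadical n k R = N_k`, and over the adeles `rationalBlock n k K = 𝔫_k(K) ≤
  𝔫_k(𝔸_K)`, `glUnipotent n k K` (`unipotentOfBlock` valued in `(gl n K).Adelic`),
  `glUnipotent_mem_quotientSubgroup` (`N_k(K) ≤ A_G GL_n(K)`, proved).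
* Constant terms without choices: `ConstantTermVanishes n K φ k` quantifies over all additive
  Haar measures `ν` on `𝔫_k(𝔸_K)` and all measurable fundamental domains `𝓕` for `𝔫_k(K)`
  (Mathlib `IsAddFundamentalDomain`, `Measure.IsAddHaarMeasure`) and asks
  `∫_𝓕 φ (x (1 + X)) dν(X) = 0` for all `x`; the integrand is `𝔫_k(K)`-periodic
  (`toAutomorphicQuotient_mul_glUnipotent_vadd`, proved).
* `cuspForms n K μ` (submodule of continuous `ℒ²` functions with vanishing constant terms,
  closure proofs real), the predicate `IsContinuousCuspForm`, the linear map `cuspFormsToLp`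
  (`MemLp.toLp`), and the **cuspidal subspace** `cuspidalSubspace n K μ : ClosedSubrep
  (rightRegular (gl n K) μ)`, the closure of its range, with a *proved* invariance under the
  regular representation (`DomMulAct.mk_smul_toLp` + continuity of `R(g)`).
* `CuspidalAutomorphicRepGL n K μ`: irreducible closed subrepresentations of `L²_cusp`
  (a subtype; `Π.1` is the closed subrepresentation), `toDiscreteAutomorphicRep`.
* Theorems (`sorry`, all under `[(gl n K).IsAutomorphicMeasure μ]`, all UNTAGGED — review F7a):
  `cuspidalSubspace_le_discreteSpectrum` (Gelfand–Piatetski-Shapiro),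
  `isDiscretelyDecomposable_cuspidal`, `cuspidalSubspace_one_eq_top` (`n = 1`),
  `exists_hasSatakeParameterAt_cofinite` (unramified almost everywhere: ONE non-zero level `𝔫`
  with Satake parameters w.r.t. `principalCongruenceLevel n K 𝔫` at cofinitely many `v` — not
  the full level `glIntegralLevel`, which would mean unramified everywhere),
  `exists_hasLocalComponentAt` and `nonempty_equiv_of_hasLocalComponentAt` (Flath);
  `multiplicity_cuspidal_lt_top` (from `AutomorphicSpectrum`) and
  `eventually_cofinite_isUnramifiedAt` (from the Satake statement via `Ideal.finite_factors`)
  are *deduced*. `standardUnipotentRadical` is recorded for the outline but unused below.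

## Design notes

* **Cosets.** `φ : GL_n(𝔸_K) ⧸ A_G GL_n(K) → ℂ` is a right-`A_G GL_n(K)`-invariant function on
  `GL_n(𝔸_K)`, so the unipotent variable multiplies on the right: `X ↦ φ [x (1 + X)]`; it is
  periodic under `𝔫_k(K)` since `unipotentOfBlock` is a homomorphism and
  `N_k(K) ≤ GL_n(K) ≤ A_G GL_n(K)`. Left translation `φ ↦ φ (g • ·)` replaces `x` by `g x`, whence
  invariance of cusp forms (`ConstantTermVanishes.comp_smul`).
* **Integrability clause.** `ConstantTermVanishes` demands `IntegrableOn` of the integrand on `𝓕`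
  together with the vanishing of its Bochner integral, so that the condition is closed under `+`
  and `•` by `integral_add/smul` (real proofs) rather than by the junk value `∫ = 0` of
  non-integrable functions. For continuous `φ` the clause is automatic (continuous periodic
  integrand with compact period quotient `𝔫_k(K) \ 𝔫_k(𝔸_K) ≅ (K \ 𝔸_K)^{k(n-k)}`, hence bounded,
  and `ν 𝓕 < ∞`).
* **Measures (outline D11, review F6).** Every theorem takes `[(gl n K).IsAutomorphicMeasure μ]`.
  The data `cuspidalSubspace`, `CuspidalAutomorphicRepGL` mention `rightRegular` and take the
  bare `[SMulInvariantMeasure _ _ μ]`; `ConstantTermVanishes`, `cuspForms`, `IsContinuousCuspForm`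
  are predicates on functions (`MemLp` needs no hypothesis on `μ`), so they carry no measure class
  at all (an instance argument would be unused and flagged by the linter).
* No `CuspidalSpectrumData (gl n K) μ` is constructed: its field `le_discreteSpectrum` is the
  `sorry`d theorem `cuspidalSubspace_le_discreteSpectrum` (H21 rule: no data through `sorry`).
  Consumers needing it write `⟨cuspidalSubspace n K μ, cuspidalSubspace_le_discreteSpectrum n K μ⟩`
  inside proofs.
* `cuspidalSubspace_one_eq_top` is left as a `sorry`: the density of continuous functions in `L²`
  needs regularity properties of `μ` on the (compact, Hausdorff — both `sorry`d upstream) quotient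
  that are not cheaply available.
* `exists_hasLocalComponentAt` quantifies the local space `V` over `Type` (universe `0`), enough
  for representations of the `Type`-valued group `GL_n(K_v)`.

## Mathlib

Used (verified by grep): `Matrix.GeneralLinearGroup`, `Multiplicative`, `MonoidHom.range`,
`AdeleRing.algebraMap_injective`, `MeasureTheory.IsAddFundamentalDomain`,
`Measure.IsAddHaarMeasure`, `AddSubgroup` translation action (`AddSubgroup.vadd_def`),
`QuotientGroup.mk_mul_of_mem`, `MulAction.Quotient.smul_mk` (as `rfl`), `MemLp.toLp`,
`MemLp.toLp_add/const_smul`, `MemLp.comp_measurePreserving`, `measurePreserving_smul`,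
`DomMulAct.mk_smul_toLp`, `Submodule.topologicalClosure`, `Set.MapsTo.closure`,
`Representation.Equiv`, `Representation.IsIrreducible`, `Ideal.finite_factors`. Mathlib has
`Matrix.BlockTriangular` and `Matrix.SpecialLinearGroup.lineStab` (stabiliser of a line in
`SL ι F` over a field — not `GL`, not over a ring, not the block `N_k`), but no standard
parabolics / unipotent radicals of `GL_n` over a commutative ring, no constant terms, no cusp
forms on adele groups (its `CuspForm` is the classical holomorphic notion on `ℍ`). No
`MeasurableSpace` instance on `AdeleRing` or matrices over it (so the `borel` instance below is
diamond-free).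

## References

* A. Borel, H. Jacquet, *Automorphic forms and automorphic representations*, Proc. Sympos. Pure
  Math. 33 (Corvallis 1979), part 1, §4.4–4.6.
* R. Godement, H. Jacquet, *Zeta functions of simple algebras*, LNM 260 (1972), §10.
* I. M. Gelfand, M. I. Graev, I. I. Piatetski-Shapiro, *Representation theory and automorphic
  functions* (1969), Ch. 3.
* D. Flath, *Decomposition of representations into tensor products*, Corvallis (1979), part 1.
* D. Bump, *Automorphic forms and representations* (1997), §3.3.
-/

noncomputable section

open scoped MatrixGroups ENNReal
open NumberField IsDedekindDomain MeasureTheory Topology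

namespace Literature.NumberTheory.Automorphic

/-! ### Unipotent radicals of the standard maximal parabolics of `GL_n` -/

section Unipotent

variable (n k : ℕ) (R : Type*) [CommRing R]

/-- The **block-nilpotent matrices** `𝔫_k = { X ∈ M_n(R) | X_{ij} ≠ 0 → i < k ≤ j }`: the Lie
algebra (an additive subgroup, indeed a square-zero two-sided ideal of the block upper-triangular
matrices) of the unipotent radical `N_k = 1 + 𝔫_k` of the standard maximal parabolic
`P_k = P_{(k, n-k)}` of `GL_n` stabilising `⟨e_1, …, e_k⟩` (Borel–Jacquet, Corvallis (1979), §4.4;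
Godement–Jacquet, LNM 260, §10; Bump, *Automorphic forms and representations*, §3.3). For
`k = 0` or `k ≥ n` it is `⊥`. Mathlib has `Matrix.BlockTriangular` and, inside `SL ι F` over a
field, `Matrix.SpecialLinearGroup.lineStab` (a unipotent-radical-type stabiliser attached to a
subspace), neither of which gives the block `𝔫_k ≤ M_n(R)` / `N_k ≤ GL_n(R)` over a general
commutative ring such as the adeles (checked by grep). [cite: Corvallis1979] -/
def blockNilpotent : AddSubgroup (Matrix (Fin n) (Fin n) R) where
  carrier := {X | ∀ i j, X i j ≠ 0 → (i : ℕ) < k ∧ k ≤ (j : ℕ)}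
  zero_mem' i j h := (h rfl).elim
  add_mem' {X Y} hX hY i j h := by
    by_cases hx : X i j = 0
    · rw [Matrix.add_apply, hx, zero_add] at h
      exact hY i j h
    · exact hX i j hx
  neg_mem' {X} hX i j h := hX i j (by simpa using h)

variable {n k R} in
/-- Membership in `𝔫_k`: every non-zero entry lies in the block `i < k ≤ j` (definitional). [folklore] -/
theorem mem_blockNilpotent_iff {X : Matrix (Fin n) (Fin n) R} :
    X ∈ blockNilpotent n k R ↔ ∀ i j, X i j ≠ 0 → (i : ℕ) < k ∧ k ≤ (j : ℕ) :=
  Iff.rfl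

variable {n k R} in
/-- Entries of `X ∈ 𝔫_k` outside the block `i < k ≤ j` vanish. [folklore] -/
theorem apply_eq_zero_of_mem_blockNilpotent {X : Matrix (Fin n) (Fin n) R}
    (hX : X ∈ blockNilpotent n k R) {i j : Fin n} (h : ¬((i : ℕ) < k ∧ k ≤ (j : ℕ))) :
    X i j = 0 := by
  by_contra hne
  exact h (hX i j hne)

variable {n k R} in
/-- `𝔫_k` has square zero: `X * Y = 0` for `X, Y ∈ 𝔫_k` (in `(X Y)_{ij} = ∑_l X_{il} Y_{lj}` a
non-zero term needs `k ≤ l` and `l < k`). Hence `N_k = 1 + 𝔫_k` is abelian and `X ↦ 1 + X` is a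
homomorphism (Borel–Jacquet (1979), §4.4). [cite: BorelJacquet1979] -/
theorem blockNilpotent_mul_self {X Y : Matrix (Fin n) (Fin n) R} (hX : X ∈ blockNilpotent n k R)
    (hY : Y ∈ blockNilpotent n k R) : X * Y = 0 := by
  ext i j
  rw [Matrix.mul_apply, Matrix.zero_apply]
  refine Finset.sum_eq_zero fun l _ => ?_
  by_cases hl : k ≤ (l : ℕ)
  · rw [apply_eq_zero_of_mem_blockNilpotent hY (fun h => absurd h.1 (not_lt.mpr hl)), mul_zero]
  · rw [apply_eq_zero_of_mem_blockNilpotent hX (fun h => hl h.2), zero_mul]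

/-- The isomorphism `𝔫_k →* N_k ≤ GL_n(R)`, `X ↦ 1 + X` (inverse `1 - X`), from the additive group
of block-nilpotent matrices (written multiplicatively) onto the **unipotent radical** of the
standard maximal parabolic `P_k`; a homomorphism because `𝔫_k² = 0`
(`blockNilpotent_mul_self`; Borel–Jacquet (1979), §4.4; Godement–Jacquet, LNM 260, §10). [cite: BorelJacquet1979] -/
def unipotentOfBlock : Multiplicative (blockNilpotent n k R) →* GL (Fin n) R where
  toFun X :=
    { val := 1 + (X.toAdd : Matrix (Fin n) (Fin n) R)
      inv := 1 - (X.toAdd : Matrix (Fin n) (Fin n) R)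
      val_inv := by
        rw [add_mul, mul_sub, mul_sub, one_mul, mul_one, one_mul,
          blockNilpotent_mul_self X.toAdd.2 X.toAdd.2]
        abel
      inv_val := by
        rw [sub_mul, mul_add, mul_add, one_mul, mul_one, one_mul,
          blockNilpotent_mul_self X.toAdd.2 X.toAdd.2]
        abel }
  map_one' := by
    ext
    simp
  map_mul' X Y := by
    refine Units.ext ?_
    change (1 : Matrix (Fin n) (Fin n) R) + ((X.toAdd : Matrix (Fin n) (Fin n) R) + Y.toAdd) =
      (1 + (X.toAdd : Matrix (Fin n) (Fin n) R)) * (1 + (Y.toAdd : Matrix (Fin n) (Fin n) R))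
    rw [add_mul, mul_add, mul_add, one_mul, mul_one, one_mul,
      blockNilpotent_mul_self X.toAdd.2 Y.toAdd.2]
    abel

variable {n k R} in
/-- The underlying matrix of `unipotentOfBlock X` is `1 + X` (definitional). [folklore] -/
@[simp]
theorem coe_unipotentOfBlock (X : Multiplicative (blockNilpotent n k R)) :
    (unipotentOfBlock n k R X : Matrix (Fin n) (Fin n) R) = 1 + (X.toAdd : Matrix (Fin n) (Fin n) R) :=
  rfl

variable {n k R} in
/-- `unipotentOfBlock` is injective (`X ↦ 1 + X`). [folklore] -/
theorem unipotentOfBlock_injective : Function.Injective (unipotentOfBlock n k R) := by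
  intro X Y h
  have h' := congrArg (fun g : GL (Fin n) R => (g : Matrix (Fin n) (Fin n) R)) h
  simp only [coe_unipotentOfBlock, add_right_inj] at h'
  exact Multiplicative.toAdd.injective (Subtype.ext h')

/-- The **unipotent radical** `N_k = 1 + 𝔫_k ≤ GL_n(R)` of the standard maximal parabolic
`P_k` (`0 < k < n`): the range of `unipotentOfBlock` (Borel–Jacquet (1979), §4.4;
Godement–Jacquet, LNM 260, §10). Every standard proper parabolic of `GL_n` is contained in a
maximal one, so cuspidality may be tested on the `N_k` alone. Recorded for the outline; not used
further in this file (constant terms are phrased through `unipotentOfBlock` directly). [cite: BorelJacquet1979] -/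
def standardUnipotentRadical : Subgroup (GL (Fin n) R) :=
  (unipotentOfBlock n k R).range

end Unipotent

/-! ### Rational points of the unipotent radical over the adeles -/

section Rational

variable (n k : ℕ) (K : Type) [Field K] [NumberField K]

/-- The **rational block-nilpotent matrices** `𝔫_k(K) ≤ 𝔫_k(𝔸_K)`: those `X ∈ 𝔫_k(𝔸_K)` all of
whose entries lie in the image of the diagonal embedding `K → 𝔸_K` (`algebraMap`). Its image
under `unipotentOfBlock` is `N_k(K) ≤ GL_n(K) ≤ A_G · GL_n(K)`, and it acts on `𝔫_k(𝔸_K)` by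
translation (Mathlib's `AddSubgroup` action) with compact quotient `𝔫_k(K) \ 𝔫_k(𝔸_K) ≅
(K \ 𝔸_K)^{k(n-k)}` (Borel–Jacquet (1979), §4.4; Cassels–Fröhlich, Ch. II §14). [cite: BorelJacquet1979] -/
def rationalBlock : AddSubgroup (blockNilpotent n k (AdeleRing (𝓞 K) K)) where
  carrier := {X | ∀ i j, (X : Matrix (Fin n) (Fin n) (AdeleRing (𝓞 K) K)) i j ∈
    (algebraMap K (AdeleRing (𝓞 K) K)).range}
  zero_mem' i j := ⟨0, by simp⟩
  add_mem' {X Y} hX hY i j := by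
    rw [AddSubgroup.coe_add, Matrix.add_apply]
    exact add_mem (hX i j) (hY i j)
  neg_mem' {X} hX i j := by
    rw [AddSubgroup.coe_neg, Matrix.neg_apply]
    exact neg_mem (hX i j)

variable {n k K} in
/-- Membership in `𝔫_k(K)`: all entries are principal adeles (definitional). [folklore] -/
theorem mem_rationalBlock_iff {X : blockNilpotent n k (AdeleRing (𝓞 K) K)} :
    X ∈ rationalBlock n k K ↔ ∀ i j, (X : Matrix (Fin n) (Fin n) (AdeleRing (𝓞 K) K)) i j ∈
      (algebraMap K (AdeleRing (𝓞 K) K)).range :=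
  Iff.rfl

/-- `unipotentOfBlock` over the adeles, valued in the group `(gl n K).Adelic = GL_n(𝔸_K)` of the
adelic datum (the same map; this spelling keeps every product `x · (1 + X)` inside the type
`(gl n K).Adelic` on which the automorphic quotient and `rightRegular` are built;
Godement–Jacquet, LNM 260, §10). [folklore] -/
def glUnipotent :
    Multiplicative (blockNilpotent n k (AdeleRing (𝓞 K) K)) →* (AdelicGroupData.gl n K).Adelic :=
  unipotentOfBlock n k (AdeleRing (𝓞 K) K)

variable {n k K} in
/-- `glUnipotent` is `unipotentOfBlock` (definitional). [folklore] -/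
theorem glUnipotent_apply (X : Multiplicative (blockNilpotent n k (AdeleRing (𝓞 K) K))) :
    glUnipotent n k K X = unipotentOfBlock n k (AdeleRing (𝓞 K) K) X :=
  rfl

variable {n k K} in
/-- `N_k(K) ≤ GL_n(K)`: the unipotent element `1 + X` of a rational block-nilpotent `X` lies in
the arithmetic subgroup `GL_n(K) ≤ GL_n(𝔸_K)`, hence in `A_G · GL_n(K)`; this is the
periodicity behind `ConstantTermVanishes` (Borel–Jacquet (1979), §4.4). [cite: BorelJacquet1979] -/
theorem glUnipotent_mem_quotientSubgroup {X : blockNilpotent n k (AdeleRing (𝓞 K) K)}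
    (hX : X ∈ rationalBlock n k K) :
    glUnipotent n k K (Multiplicative.ofAdd X) ∈ (AdelicGroupData.gl n K).quotientSubgroup := by
  classical
  choose x hx using hX
  set Xr : Matrix (Fin n) (Fin n) K := Matrix.of fun i j => x i j with hXr
  have hXr_mem : Xr ∈ blockNilpotent n k K := by
    intro i j hij
    refine X.2 i j ?_
    rw [← hx i j]
    exact (map_ne_zero_iff _ (AdeleRing.algebraMap_injective (𝓞 K) K)).mpr hij
  refine (AdelicGroupData.gl n K).arithmeticSubgroup_le_quotientSubgroup
    ⟨unipotentOfBlock n k K (Multiplicative.ofAdd ⟨Xr, hXr_mem⟩), ?_⟩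
  refine Units.ext (Matrix.ext fun i j => ?_)
  change algebraMap K (AdeleRing (𝓞 K) K) ((1 + Xr) i j) =
    (1 + (X : Matrix (Fin n) (Fin n) (AdeleRing (𝓞 K) K))) i j
  rw [Matrix.add_apply, Matrix.add_apply, map_add, hXr, Matrix.of_apply, hx i j,
    Matrix.one_apply, Matrix.one_apply]
  split_ifs <;> simp

/-- The Borel σ-algebra on `𝔫_k(𝔸_K)` (subspace topology from `M_n(𝔸_K)`; Mathlib `borel`).
Mathlib has no `MeasurableSpace` instance on `AdeleRing`, on `Matrix _ _ (AdeleRing _ _)` or on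
their additive subgroups (checked), so this instance creates no diamond; should Mathlib acquire
one on the adeles, this instance must be revisited. Non-vacuity of `ConstantTermVanishes`:
`𝔫_k(𝔸_K) ≅ 𝔸_K^{k(n-k)}` is a closed subgroup of the locally compact second-countable additive
group `M_n(𝔸_K)`, hence carries an additive Haar measure, and the discrete cocompact subgroup
`𝔫_k(K)` admits a measurable (indeed Borel) fundamental domain (Cassels–Fröhlich, Ch. II §14;
the pin has no `LocallyCompactSpace (AdeleRing _ _)` instance, so this is not derived here). [folklore] -/
instance instMeasurableSpaceBlockNilpotent :
    MeasurableSpace (blockNilpotent n k (AdeleRing (𝓞 K) K)) :=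
  borel _

/-- The σ-algebra on `𝔫_k(𝔸_K)` is Borel by definition (Mathlib `BorelSpace`). [folklore] -/
instance instBorelSpaceBlockNilpotent : BorelSpace (blockNilpotent n k (AdeleRing (𝓞 K) K)) :=
  ⟨rfl⟩

end Rational

/-! ### The action on the automorphic quotient -/

/-- `g • [y] = [g y]` on the automorphic quotient `G(𝔸_K) ⧸ A_G G(K)` (Mathlib
`MulAction.Quotient.smul_mk`, definitional). Dot-notation lemma on the H21 structure
`AdelicGroupData`. [folklore] -/
theorem AdelicGroupData.smul_toAutomorphicQuotient {K : Type} [Field K] [NumberField K]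
    (𝒢 : AdelicGroupData K) (g y : 𝒢.Adelic) :
    g • 𝒢.toAutomorphicQuotient y = 𝒢.toAutomorphicQuotient (g * y) :=
  rfl

/-! ### Constant terms and continuous cusp forms -/

section CuspForm

variable (n : ℕ) (K : Type) [Field K] [NumberField K]

/-- The **constant term** of `φ` along the standard maximal parabolic `P_k` **vanishes**:
for every additive Haar measure `ν` on `𝔫_k(𝔸_K) ≅ N_k(𝔸_K)`, every measurable fundamental
domain `𝓕` for the translation action of `𝔫_k(K)` (so `𝓕 ≃ N_k(K) \ N_k(𝔸_K)`), and every
`x ∈ GL_n(𝔸_K)`, the function `X ↦ φ (x (1 + X) · A_G GL_n(K))` is integrable on `𝓕` and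
`∫_{𝓕} φ (x (1 + X)) dν(X) = 0`, i.e. classically `∫_{N_k(K) \ N_k(𝔸_K)} φ(x u) du = 0`
(Borel–Jacquet, Corvallis (1979), §4.4; Godement–Jacquet, LNM 260, §10;
Gelfand–Graev–Piatetski-Shapiro (1969), Ch. 3 §1). Conventions: `φ` is a function on the
left-coset space `GL_n(𝔸_K) ⧸ A_G GL_n(K)`, i.e. a *right*-`A_G GL_n(K)`-invariant function on
`GL_n(𝔸_K)`, whence the unipotent variable multiplies on the right; the integrand is
`𝔫_k(K)`-periodic in `X` because `unipotentOfBlock` is a homomorphism and `N_k(K) ≤ GL_n(K) ≤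
A_G GL_n(K)` (`glUnipotent_mem_quotientSubgroup`), so the integral does not depend on
`𝓕`, and quantifying over all `(ν, 𝓕)` avoids any choice. The integrability clause makes the
predicate closed under sums (Bochner integrals of non-integrable functions are junk `0`); it is
automatic for continuous `φ`, the integrand being continuous and periodic with compact period
quotient, hence bounded, and `ν 𝓕 < ∞`. [cite: Corvallis1979] -/
def ConstantTermVanishes (φ : (AdelicGroupData.gl n K).automorphicQuotient → ℂ) (k : ℕ) : Prop :=
  ∀ (ν : Measure (blockNilpotent n k (AdeleRing (𝓞 K) K))) [ν.IsAddHaarMeasure]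
    (𝓕 : Set (blockNilpotent n k (AdeleRing (𝓞 K) K))),
    IsAddFundamentalDomain (rationalBlock n k K) 𝓕 ν →
      ∀ x : (AdelicGroupData.gl n K).Adelic,
        IntegrableOn (fun X => φ ((AdelicGroupData.gl n K).toAutomorphicQuotient
          (x * glUnipotent n k K (Multiplicative.ofAdd X)))) 𝓕 ν ∧
        ∫ X in 𝓕, φ ((AdelicGroupData.gl n K).toAutomorphicQuotient
          (x * glUnipotent n k K (Multiplicative.ofAdd X))) ∂ν = 0

variable {n K}

/-- **Periodicity of the constant-term integrand.** For `γ ∈ 𝔫_k(K)` and any `X ∈ 𝔫_k(𝔸_K)`,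
`x (1 + (γ + X)) ≡ x (1 + X)` in `GL_n(𝔸_K) ⧸ A_G GL_n(K)`: indeed `1 + (X + γ) = (1 + X)(1 + γ)`
(`𝔫_k² = 0`) and `1 + γ ∈ GL_n(K) ≤ A_G GL_n(K)` (`glUnipotent_mem_quotientSubgroup`, Mathlib
`QuotientGroup.mk_mul_of_mem`). So the integrand of `ConstantTermVanishes` is invariant under the
translation action `γ +ᵥ X = γ + X` of `rationalBlock`, and its integral over a fundamental
domain is the integral over `N_k(K) \ N_k(𝔸_K)` (Borel–Jacquet (1979), §4.4). [cite: BorelJacquet1979] -/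
theorem toAutomorphicQuotient_mul_glUnipotent_vadd
    (φ : (AdelicGroupData.gl n K).automorphicQuotient → ℂ) {k : ℕ}
    (x : (AdelicGroupData.gl n K).Adelic) (γ : rationalBlock n k K)
    (X : blockNilpotent n k (AdeleRing (𝓞 K) K)) :
    φ ((AdelicGroupData.gl n K).toAutomorphicQuotient
        (x * glUnipotent n k K (Multiplicative.ofAdd (γ +ᵥ X)))) =
      φ ((AdelicGroupData.gl n K).toAutomorphicQuotient
        (x * glUnipotent n k K (Multiplicative.ofAdd X))) := by
  congr 1
  rw [AddSubgroup.vadd_def, vadd_eq_add, add_comm, ofAdd_add, map_mul, ← mul_assoc]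
  exact QuotientGroup.mk_mul_of_mem _ (glUnipotent_mem_quotientSubgroup γ.2)

/-- The zero function has vanishing constant terms. [folklore] -/
theorem constantTermVanishes_zero (k : ℕ) :
    ConstantTermVanishes n K (0 : (AdelicGroupData.gl n K).automorphicQuotient → ℂ) k := by
  intro ν _ 𝓕 _ x
  exact ⟨integrableOn_zero, by simp⟩

/-- Vanishing of constant terms is preserved under sums (`integral_add`, using the
integrability clause). [folklore] -/
theorem ConstantTermVanishes.add {φ ψ : (AdelicGroupData.gl n K).automorphicQuotient → ℂ}
    {k : ℕ} (hφ : ConstantTermVanishes n K φ k) (hψ : ConstantTermVanishes n K ψ k) :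
    ConstantTermVanishes n K (φ + ψ) k := by
  intro ν _ 𝓕 h𝓕 x
  obtain ⟨hφi, hφ0⟩ := hφ ν 𝓕 h𝓕 x
  obtain ⟨hψi, hψ0⟩ := hψ ν 𝓕 h𝓕 x
  refine ⟨hφi.add hψi, ?_⟩
  change ∫ X in 𝓕, φ _ + ψ _ ∂ν = 0
  rw [integral_add hφi hψi, hφ0, hψ0, add_zero]

/-- Vanishing of constant terms is preserved under scalar multiplication (`integral_smul`). [folklore] -/
theorem ConstantTermVanishes.smul {φ : (AdelicGroupData.gl n K).automorphicQuotient → ℂ}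
    {k : ℕ} (c : ℂ) (hφ : ConstantTermVanishes n K φ k) :
    ConstantTermVanishes n K (c • φ) k := by
  intro ν _ 𝓕 h𝓕 x
  obtain ⟨hφi, hφ0⟩ := hφ ν 𝓕 h𝓕 x
  refine ⟨hφi.smul c, ?_⟩
  change ∫ X in 𝓕, c • φ _ ∂ν = 0
  rw [integral_smul, hφ0, smul_zero]

/-- Vanishing of constant terms is invariant under left translation of the argument:
if `φ` has vanishing `k`-th constant terms then so has `y ↦ φ (g • y)` (replace `x` by `g x`
in the definition; `g • (y · A_G GL_n(K)) = (g y) · A_G GL_n(K)`). [folklore] -/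
theorem ConstantTermVanishes.comp_smul {φ : (AdelicGroupData.gl n K).automorphicQuotient → ℂ}
    {k : ℕ} (hφ : ConstantTermVanishes n K φ k) (g : (AdelicGroupData.gl n K).Adelic) :
    ConstantTermVanishes n K (fun y => φ (g • y)) k := by
  intro ν _ 𝓕 h𝓕 x
  obtain ⟨hφi, hφ0⟩ := hφ ν 𝓕 h𝓕 (g * x)
  simp_rw [AdelicGroupData.smul_toAutomorphicQuotient, ← mul_assoc]
  exact ⟨hφi, hφ0⟩

variable (n K)
variable (μ : Measure (AdelicGroupData.gl n K).automorphicQuotient)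

/-- The space of **continuous square-integrable cusp forms** on `GL_n(𝔸_K) ⧸ A_G GL_n(K)`:
continuous `φ` with `φ ∈ ℒ²(μ)` all of whose constant terms along the standard maximal
parabolics `P_k`, `0 < k < n`, vanish (Borel–Jacquet (1979), §4.4–4.6; Godement–Jacquet,
LNM 260, §10). A `ℂ`-submodule of the space of functions (closure under `+`, `•` by
`ConstantTermVanishes.add/smul` and `MemLp.add/const_smul`). No hypothesis on `μ` is needed to
*form* this submodule; see `IsContinuousCuspForm` / `mem_cuspForms_iff` for the membership
predicate under an automorphic measure. [cite: BorelJacquet1979] -/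
def cuspForms : Submodule ℂ ((AdelicGroupData.gl n K).automorphicQuotient → ℂ) where
  carrier := {φ | Continuous φ ∧ MemLp φ 2 μ ∧ ∀ k, 0 < k → k < n → ConstantTermVanishes n K φ k}
  zero_mem' := ⟨continuous_zero, MemLp.zero, fun k _ _ => constantTermVanishes_zero k⟩
  add_mem' hφ hψ := ⟨hφ.1.add hψ.1, hφ.2.1.add hψ.2.1,
    fun k hk hkn => (hφ.2.2 k hk hkn).add (hψ.2.2 k hk hkn)⟩
  smul_mem' c _ hφ := ⟨hφ.1.const_smul c, hφ.2.1.const_smul c,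
    fun k hk hkn => (hφ.2.2 k hk hkn).smul c⟩

variable {n K μ} in
/-- Membership in `cuspForms` (definitional unfolding). [folklore] -/
theorem mem_cuspForms {φ : (AdelicGroupData.gl n K).automorphicQuotient → ℂ} :
    φ ∈ cuspForms n K μ ↔
      Continuous φ ∧ MemLp φ 2 μ ∧ ∀ k, 0 < k → k < n → ConstantTermVanishes n K φ k :=
  Iff.rfl

variable {n K μ} in
/-- A cusp form is square-integrable. [folklore] -/
theorem memLp_of_mem_cuspForms {φ : (AdelicGroupData.gl n K).automorphicQuotient → ℂ}
    (hφ : φ ∈ cuspForms n K μ) : MemLp φ 2 μ :=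
  hφ.2.1

/-- `φ` is a **continuous square-integrable cusp form** on `GL_n(𝔸_K) ⧸ A_G GL_n(K)` for the
automorphic measure `μ`: `φ` is continuous, `φ ∈ ℒ²(μ)`, and all constant terms of `φ` along the
standard maximal parabolics `P_k` (`0 < k < n`) vanish (Borel–Jacquet (1979), §4.4–4.6;
Godement–Jacquet, LNM 260, §10; Gelfand–Graev–Piatetski-Shapiro (1969), Ch. 3 §1). This is
membership in `cuspForms n K μ` (`mem_cuspForms_iff`). As a predicate on *functions* it needs no
hypothesis on `μ` (an instance argument would be unused); all theorems about it below assume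
`[IsAutomorphicMeasure μ]` (outline D11). For `n = 1` the parabolic condition is empty. [cite: BorelJacquet1979] -/
def IsContinuousCuspForm (φ : (AdelicGroupData.gl n K).automorphicQuotient → ℂ) : Prop :=
  Continuous φ ∧ MemLp φ 2 μ ∧ ∀ k, 0 < k → k < n → ConstantTermVanishes n K φ k

variable {n K μ} in
/-- `IsContinuousCuspForm` is membership in the submodule `cuspForms` (definitional). [folklore] -/
theorem mem_cuspForms_iff {φ : (AdelicGroupData.gl n K).automorphicQuotient → ℂ} :
    φ ∈ cuspForms n K μ ↔ IsContinuousCuspForm n K μ φ :=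
  Iff.rfl

variable {n K μ} in
/-- A continuous cusp form is square-integrable. [folklore] -/
theorem IsContinuousCuspForm.memLp {φ : (AdelicGroupData.gl n K).automorphicQuotient → ℂ}
    (hφ : IsContinuousCuspForm n K μ φ) : MemLp φ 2 μ :=
  hφ.2.1

variable {n K μ} in
/-- A continuous cusp form is continuous. [folklore] -/
theorem IsContinuousCuspForm.continuous {φ : (AdelicGroupData.gl n K).automorphicQuotient → ℂ}
    (hφ : IsContinuousCuspForm n K μ φ) : Continuous φ :=
  hφ.1

variable {n K μ} in
/-- The constant terms of a continuous cusp form vanish. [folklore] -/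
theorem IsContinuousCuspForm.constantTermVanishes
    {φ : (AdelicGroupData.gl n K).automorphicQuotient → ℂ} (hφ : IsContinuousCuspForm n K μ φ)
    {k : ℕ} (hk : 0 < k) (hkn : k < n) : ConstantTermVanishes n K φ k :=
  hφ.2.2 k hk hkn

/-- The linear map `cuspForms n K μ →ₗ[ℂ] L²(μ)` sending a continuous square-integrable cusp form
to its class in `L²` (Mathlib `MemLp.toLp`, linear by `MemLp.toLp_add`, `MemLp.toLp_const_smul`;
Borel–Jacquet (1979), §4.6). [cite: BorelJacquet1979] -/
def cuspFormsToLp : cuspForms n K μ →ₗ[ℂ] (AdelicGroupData.gl n K).L2 μ where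
  toFun φ := (memLp_of_mem_cuspForms φ.2).toLp (φ : (AdelicGroupData.gl n K).automorphicQuotient → ℂ)
  map_add' _ _ := by
    rw [← MemLp.toLp_add]
    rfl
  map_smul' _ _ := by
    rw [← MemLp.toLp_const_smul]
    rfl

variable {n K μ} in
/-- `cuspFormsToLp φ = toLp φ` (definitional). [folklore] -/
theorem cuspFormsToLp_apply (φ : cuspForms n K μ) :
    cuspFormsToLp n K μ φ =
      (memLp_of_mem_cuspForms φ.2).toLp (φ : (AdelicGroupData.gl n K).automorphicQuotient → ℂ) :=
  rfl

variable [SMulInvariantMeasure (AdelicGroupData.gl n K).Adelic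
  (AdelicGroupData.gl n K).automorphicQuotient μ]

variable {n K μ} in
/-- Left translates of continuous cusp forms are continuous cusp forms: if `φ ∈ cuspForms` then
`y ↦ φ (g • y)` is in `cuspForms` (continuity of the action, invariance of `μ` via
`MemLp.comp_measurePreserving`, and `ConstantTermVanishes.comp_smul`;
Borel–Jacquet (1979), §4.4). [cite: BorelJacquet1979] -/
theorem comp_smul_mem_cuspForms {φ : (AdelicGroupData.gl n K).automorphicQuotient → ℂ}
    (hφ : φ ∈ cuspForms n K μ) (g : (AdelicGroupData.gl n K).Adelic) :
    (fun y => φ (g • y)) ∈ cuspForms n K μ :=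
  ⟨hφ.1.comp (continuous_const_smul g),
    hφ.2.1.comp_measurePreserving (measurePreserving_smul g μ),
    fun k hk hkn => (hφ.2.2 k hk hkn).comp_smul g⟩

variable {n K μ} in
/-- Left translates of continuous cusp forms are continuous cusp forms
(`comp_smul_mem_cuspForms`; Borel–Jacquet (1979), §4.4). Only invariance of `μ` is needed. [cite: BorelJacquet1979] -/
theorem IsContinuousCuspForm.comp_smul {φ : (AdelicGroupData.gl n K).automorphicQuotient → ℂ}
    (hφ : IsContinuousCuspForm n K μ φ) (g : (AdelicGroupData.gl n K).Adelic) :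
    IsContinuousCuspForm n K μ fun y => φ (g • y) :=
  comp_smul_mem_cuspForms hφ g

variable {n K μ} in
/-- The regular representation maps the image of `cuspForms` in `L²` into itself:
`R(g) [φ] = [φ (g⁻¹ • ·)]` (Mathlib `DomMulAct.mk_smul_toLp`). [folklore] -/
theorem rightRegular_apply_mem_range_cuspFormsToLp (g : (AdelicGroupData.gl n K).Adelic)
    {f : (AdelicGroupData.gl n K).L2 μ} (hf : f ∈ LinearMap.range (cuspFormsToLp n K μ)) :
    (AdelicGroupData.gl n K).rightRegular μ g f ∈ LinearMap.range (cuspFormsToLp n K μ) := by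
  obtain ⟨φ, rfl⟩ := hf
  refine ⟨⟨fun y => (φ : (AdelicGroupData.gl n K).automorphicQuotient → ℂ) (g⁻¹ • y),
    comp_smul_mem_cuspForms φ.2 g⁻¹⟩, ?_⟩
  rw [AdelicGroupData.rightRegular_apply, cuspFormsToLp_apply, cuspFormsToLp_apply,
    DomMulAct.mk_smul_toLp]

/-- The **cuspidal subspace** `L²_cusp(GL_n(𝔸_K) ⧸ A_G GL_n(K)) ≤ L²`: the closure in `L²(μ)` of
the image of the continuous square-integrable cusp forms, as a closed subrepresentation of the
regular representation. Invariance is proved: `R(g)` maps the image of `cuspForms` into itself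
(`rightRegular_apply_mem_range_cuspFormsToLp`) and is continuous, so it preserves the closure
(Borel–Jacquet (1979), §4.4–4.6; Godement–Jacquet, LNM 260, §10; Gelfand–Graev–Piatetski-Shapiro
(1969), Ch. 3). Only the bare invariance of `μ` is assumed, to mention `rightRegular`
(outline D11). [cite: BorelJacquet1979] -/
def cuspidalSubspace :
    ContRepresentation.ClosedSubrep ((AdelicGroupData.gl n K).rightRegular μ) where
  toSubmodule := (LinearMap.range (cuspFormsToLp n K μ)).topologicalClosure
  apply_mem_toSubmodule g f hf := by
    have hmaps : Set.MapsTo ((AdelicGroupData.gl n K).rightRegular μ g)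
        (LinearMap.range (cuspFormsToLp n K μ) : Set ((AdelicGroupData.gl n K).L2 μ))
        (LinearMap.range (cuspFormsToLp n K μ) : Set ((AdelicGroupData.gl n K).L2 μ)) :=
      fun f hf => rightRegular_apply_mem_range_cuspFormsToLp g hf
    have hcl := hmaps.closure ((AdelicGroupData.gl n K).rightRegular μ g).continuous
    rw [← Submodule.topologicalClosure_coe] at hcl
    exact hcl hf
  isClosed' := Submodule.isClosed_topologicalClosure _

/-- The submodule underlying `cuspidalSubspace` is the closure of the image of `cuspForms`
(definitional). [folklore] -/
theorem toSubmodule_cuspidalSubspace :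
    (cuspidalSubspace n K μ).toSubmodule =
      (LinearMap.range (cuspFormsToLp n K μ)).topologicalClosure :=
  rfl

variable {n K μ} in
/-- The `L²`-class of a continuous cusp form lies in the cuspidal subspace `L²_cusp`
(Borel–Jacquet (1979), §4.6; Mathlib `Submodule.le_topologicalClosure`). Only invariance of
`μ` is needed (to form `cuspidalSubspace`). [cite: BorelJacquet1979] -/
theorem mem_cuspidalSubspace_of_isContinuousCuspForm
    {φ : (AdelicGroupData.gl n K).automorphicQuotient → ℂ} (hφ : IsContinuousCuspForm n K μ φ) :
    hφ.memLp.toLp φ ∈ cuspidalSubspace n K μ :=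
  Submodule.le_topologicalClosure _ ⟨⟨φ, hφ⟩, rfl⟩

/-- A **cuspidal automorphic representation of `GL_n(𝔸_K)`** (with respect to the automorphic
measure `μ`): a topologically irreducible closed `GL_n(𝔸_K)`-invariant subspace of
`L²_cusp(GL_n(𝔸_K) ⧸ A_G GL_n(K))` (Borel–Jacquet (1979), §4.6; Godement–Jacquet, LNM 260, §10).
A subtype of `ClosedSubrep (rightRegular (gl n K) μ)`; `Π.1` (or the coercion) is the underlying
closed subrepresentation. No `CuspidalSpectrumData` is built from it, because
`L²_cusp ≤ L²_disc` is the `sorry`d theorem `cuspidalSubspace_le_discreteSpectrum`. [cite: BorelJacquet1979] -/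
def CuspidalAutomorphicRepGL : Type :=
  {W : ContRepresentation.ClosedSubrep ((AdelicGroupData.gl n K).rightRegular μ) //
    W ≤ cuspidalSubspace n K μ ∧ W.toContRep.IsTopIrreducible}

namespace CuspidalAutomorphicRepGL

variable {n K μ}

/-- The underlying closed subrepresentation of `L²` of a cuspidal automorphic representation. [folklore] -/
instance instCoeOut : CoeOut (CuspidalAutomorphicRepGL n K μ)
    (ContRepresentation.ClosedSubrep ((AdelicGroupData.gl n K).rightRegular μ)) :=
  ⟨Subtype.val⟩

/-- A cuspidal automorphic representation lies in `L²_cusp` (Borel–Jacquet (1979), §4.6). [cite: BorelJacquet1979] -/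
theorem le_cuspidalSubspace (P : CuspidalAutomorphicRepGL n K μ) : P.1 ≤ cuspidalSubspace n K μ :=
  P.2.1

/-- A cuspidal automorphic representation is topologically irreducible
(Borel–Jacquet (1979), §4.6). [cite: BorelJacquet1979] -/
theorem isTopIrreducible (P : CuspidalAutomorphicRepGL n K μ) : P.1.toContRep.IsTopIrreducible :=
  P.2.2

/-- A cuspidal automorphic representation as a discrete automorphic representation (forgetting
cuspidality; Borel–Jacquet (1979), §4.6). [cite: BorelJacquet1979] -/
def toDiscreteAutomorphicRep (P : CuspidalAutomorphicRepGL n K μ) :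
    DiscreteAutomorphicRep (AdelicGroupData.gl n K) μ :=
  ⟨P.1, P.2.2⟩

/-- The space of `P.toDiscreteAutomorphicRep` is `P` (definitional). [folklore] -/
@[simp]
theorem toDiscreteAutomorphicRep_space (P : CuspidalAutomorphicRepGL n K μ) :
    P.toDiscreteAutomorphicRep.space = P.1 :=
  rfl

end CuspidalAutomorphicRepGL

end CuspForm

/-! ### Cusp forms and the cuspidal spectrum for an automorphic measure -/

section Spectrum

variable (n : ℕ) (K : Type) [Field K] [NumberField K]
  (μ : Measure (AdelicGroupData.gl n K).automorphicQuotient)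
  [(AdelicGroupData.gl n K).IsAutomorphicMeasure μ]

/-- **Gelfand–Piatetski-Shapiro.** The cuspidal spectrum is contained in the discrete spectrum:
`L²_cusp(GL_n(𝔸_K) ⧸ A_G GL_n(K)) ≤ L²_disc`, i.e. `L²_cusp` is a Hilbert direct sum of
irreducible representations (the operators `R(f)`, `f ∈ C_c(GL_n(𝔸_K))`, are compact on
`L²_cusp`; Gelfand–Graev–Piatetski-Shapiro (1969), Ch. 3; Borel–Jacquet (1979), §4.6;
Godement, *The spectral decomposition of cusp forms*, Proc. Sympos. Pure Math. 9 (1966), §3).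
Untagged (review F7a). [cite: GelfandGraevPiatetskiShapiro1969] -/
def GLnCuspidalSpectrum.cuspidalSubspace_le_discreteSpectrum : Prop :=
  cuspidalSubspace n K μ ≤ (AdelicGroupData.gl n K).discreteSpectrum μ

/-- **Discrete decomposability of the cuspidal spectrum.** The regular representation on
`L²_cusp(GL_n(𝔸_K) ⧸ A_G GL_n(K))` is the closed span of its irreducible closed
subrepresentations (Gelfand–Graev–Piatetski-Shapiro (1969), Ch. 3; Borel–Jacquet (1979),
§4.6). [cite: GelfandGraevPiatetskiShapiro1969] -/
def GLnCuspidalSpectrum.isDiscretelyDecomposable_cuspidal : Prop :=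
  (cuspidalSubspace n K μ).toContRep.IsDiscretelyDecomposable

/-- **The case `n = 1`.** For `GL₁` there is no proper parabolic subgroup, so every continuous
`L²` function is a cusp form and `L²_cusp(𝔸_Kˣ ⧸ ℝ_{>0} Kˣ) = L²` (the continuous
square-integrable functions are dense in `L²` of the finite Radon measure `μ` on the compact
Hausdorff group `C_K¹`; Borel–Jacquet (1979), §4.4; Rudin, *Real and complex analysis*,
Thm. 3.14). With outline D10 this is the honest Hecke/Tate dictionary: the cuspidal automorphic
representations of `GL₁` are the unitary Hecke characters trivial on `ℝ_{>0}`. [cite: BorelJacquet1979] -/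
def cuspidalSubspace_one_eq_top : Prop :=
  ∀ (μ : Measure (AdelicGroupData.gl 1 K).automorphicQuotient) [(AdelicGroupData.gl 1 K).IsAutomorphicMeasure μ],
    cuspidalSubspace 1 K μ = ⊤

variable {n K μ}

/-- **Finite multiplicity of cuspidal representations.** A cuspidal automorphic representation
`Π` of `GL_n(𝔸_K)` occurs in `L²(GL_n(𝔸_K) ⧸ A_G GL_n(K))` with finite multiplicity
(Gelfand–Graev–Piatetski-Shapiro (1969), Ch. 3; Borel–Jacquet (1979), §4.6; in fact with
multiplicity one, Shalika (1974) — not asserted here). Deduced from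
`multiplicity_lt_top_of_mem_discreteSpectrum` of `AutomorphicSpectrum`. [cite: GelfandGraevPiatetskiShapiro1969] -/
def multiplicity_cuspidal_lt_top : Prop :=
  ∀ (P : CuspidalAutomorphicRepGL n K μ),
    ((AdelicGroupData.gl n K).rightRegular μ).multiplicity P.1.toContRep < ⊤

/- interim proof relied on results that are now named facts (D-0014); demoted to a fact by the M5 import, proof preserved:
:=
  multiplicity_lt_top_of_mem_discreteSpectrum P.toDiscreteAutomorphicRep
-/

/-- **Cuspidal representations are unramified almost everywhere.** For a cuspidal automorphic
representation `Π` of `GL_n(𝔸_K)` there is ONE non-zero level `𝔫 ⊆ 𝓞 K` (a conductor-type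
ideal: `Π` has a non-zero `K(𝔫)`-fixed vector, `K(𝔫) = principalCongruenceLevel n K 𝔫`) such
that at all but finitely many finite places `v` there are a uniformizer `ϖ_v` and a Satake
parameter `α_v` (a multiset of `n` complex numbers) with respect to `K(𝔫)`, which is the maximal
compact `GL_n(𝒪_v)` at every `v ∤ 𝔫` (Flath, *Decomposition of representations into tensor
products*, Corvallis (1979), Thm. 3; Borel–Jacquet (1979), §4.6: `Π ≅ ⊗' Π_v` with `Π_v`
unramified for almost all `v`, plus admissibility of cuspidal representations). The full level
`glIntegralLevel` would wrongly force `Π` to be unramified everywhere (review of C13). [cite: Corvallis1979] -/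
def exists_hasSatakeParameterAt_cofinite : Prop :=
  ∀ (P : CuspidalAutomorphicRepGL n K μ),
    ∃ 𝔫 : Ideal (𝓞 K), 𝔫 ≠ 0 ∧ ∀ᶠ v in Filter.cofinite,
      ∃ (ϖ : (v.adicCompletion K)ˣ) (α : Multiset ℂ),
        HasSatakeParameterAt P.1 (principalCongruenceLevel n K 𝔫) v ϖ α

/-- A cuspidal automorphic representation is unramified (`IsUnramifiedAt`) at all but finitely
many finite places (Borel–Jacquet (1979), §4.6). Deduced from
`exists_hasSatakeParameterAt_cofinite`: a non-zero ideal of `𝓞 K` has finitely many prime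
divisors (Mathlib `Ideal.finite_factors`). [cite: BorelJacquet1979] -/
def eventually_cofinite_isUnramifiedAt : Prop :=
  ∀ (P : CuspidalAutomorphicRepGL n K μ),
    ∀ᶠ v in Filter.cofinite, IsUnramifiedAt P.1 v

/- interim proof relied on results that are now named facts (D-0014); demoted to a fact by the M5 import, proof preserved:
:= by
  obtain ⟨𝔫, h𝔫, h⟩ := exists_hasSatakeParameterAt_cofinite P
  have hfin : ∀ᶠ v : HeightOneSpectrum (𝓞 K) in Filter.cofinite, ¬ v.asIdeal ∣ 𝔫 :=
    (Ideal.finite_factors h𝔫).compl_mem_cofinite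
  filter_upwards [h, hfin] with v hv hv'
  obtain ⟨ϖ, α, hϖ⟩ := hv
  exact ⟨𝔫, h𝔫, hv', ϖ, α, hϖ⟩
-/

/-- **Existence of local components (Flath).** A cuspidal automorphic representation `Π` of
`GL_n(𝔸_K)` has, at every finite place `v`, an irreducible admissible local component: an
irreducible admissible representation `ρ` of `GL_n(K_v)` (on a complex vector space `V`, taken
in `Type`) together with a non-zero `GL_n(K_v)`-equivariant map `V → Π` along
`GL_n(K_v) ↪ GL_n(𝔸_K)` (`HasLocalComponentAt`; Flath (1979), Thm. 3 and Thm. 4: `Π^∞ ≅ ⊗' Π_v`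
with `Π_v` irreducible admissible; Borel–Jacquet (1979), §4.6; Bump, *Automorphic forms and
representations*, Thm. 3.3.3 for `n = 2`). [cite: Flath1979] -/
def exists_hasLocalComponentAt : Prop :=
  ∀ (P : CuspidalAutomorphicRepGL n K μ) (v : HeightOneSpectrum (𝓞 K)),
    ∃ (V : Type) (_ : AddCommGroup V) (_ : Module ℂ V)
      (ρ : Representation ℂ (GL (Fin n) (v.adicCompletion K)) V),
      ρ.IsIrreducible ∧ ρ.IsAdmissible ∧ HasLocalComponentAt P.1 v ρ

/-- **Uniqueness of local components.** Two irreducible admissible local components of a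
cuspidal automorphic representation `Π` at the same finite place `v` are isomorphic as
representations of `GL_n(K_v)` (Mathlib `Representation.Equiv`; Flath (1979), Thm. 3–4:
the local factor `Π_v` of `Π ≅ ⊗' Π_v` is determined up to isomorphism; Bump, Thm. 3.3.3). [cite: Flath1979] -/
def nonempty_equiv_of_hasLocalComponentAt : Prop :=
  ∀ (P : CuspidalAutomorphicRepGL n K μ) (v : HeightOneSpectrum (𝓞 K)) {V V' : Type*} [AddCommGroup V] [Module ℂ V] [AddCommGroup V'] [Module ℂ V'] {ρ : Representation ℂ (GL (Fin n) (v.adicCompletion K)) V} {ρ' : Representation ℂ (GL (Fin n) (v.adicCompletion K)) V'} (hρ : ρ.IsIrreducible) (hρa : ρ.IsAdmissible) (h : HasLocalComponentAt P.1 v ρ) (hρ' : ρ'.IsIrreducible) (hρ'a : ρ'.IsAdmissible) (h' : HasLocalComponentAt P.1 v ρ'),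
    Nonempty (ρ.Equiv ρ')

end Spectrum

end Literature.NumberTheory.Automorphic
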